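import Summits.Ventures.PercRepro.RankLevelSetAbsorbStarLow

/-! # RankLevelSetAbsorbStarThreeExcess — THE UP- AND DOWN-NEIGHBOURS OF A MEMBER AND THE EXCESS COUNT
`#upNbrs Z = #E − (k + 1 + #excess Z)`, `#excess Z ≤ k − 1` (night-1 g34; dossier §46; the step `k = 3` of
(ABS-star) is proved on top of this in `RankLevelSetAbsorbStarThree`)

For a finite matroid `M` on `n = #E` elements, `y ∈ E` and a member `Z ∈ A^y_k = lowAbsorbAt M y k` (g28/g32), the
EXCESS of `Z` is `cl Z ∖ (Z ∪ {y})`: it lies in the independent set `E ∖ Z` and, together with `y`, inside the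
rank-`k` flat `cl Z`, so it has at most `k − 1` elements (`ncard_excess_le`, `card_exFinset_le`). The UP-NEIGHBOURS
of `Z` are the members `W ∈ A^y_{k+1}` containing `Z`; they are exactly the sets `insert e Z` with `e ∈ E ∖ cl Z`
(`card_upNbrs`), so `#upNbrs Z + (k + 1 + #excess Z) = #E` (`card_upNbrs_eq`, `card_clFinset_eq`) and a member has
at least `#E − 2k` up-neighbours (`card_upNbrs_ge`). The DOWN-NEIGHBOURS of `W ∈ A^y_{k+1}` are the members
`Z ⊆ W` at level `k`; each is `W.erase e` for some `e ∈ W` (`exists_erase_of_mem_downNbrs`), and at level `3` a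
FULL excess `{f, g}` of a down-neighbour `Z = W ∖ {e}` makes `{f, g, y}` span `cl Z ⊇ Z`, putting every other
element of `W` into `cl (E ∖ W)` and leaving `Z` as the only down-neighbour (`downNbrs_eq_singleton_of_excess`).
These are the
ingredients of the rational double counting `Σ_Z 1 = Σ_{(Z, W)} 1/#upNbrs Z = Σ_W Σ_{Z ⊂ W} 1/#upNbrs Z` behind
the step `k = 3` (the LOCAL CHARGING (L) of dossier §46.5: uniform spreading of each member over its up-neighbours).
Nothing here asserts (ABS-star); every declaration has a docstring; imports: the cell's own modules and Mathlib only.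
Axioms: standard. -/

namespace PercRepro

open Set Matroid

variable {α : Type} [DecidableEq α] (M : Matroid α) [M.Finite]

/-! ## The excess of a member and its closure as `Finset`s; up- and down-neighbours -/

omit [DecidableEq α] in
/-- **The excess of a member at level `k` has at most `k − 1` elements**: `X := cl Z ∖ (Z ∪ {y})` lies in the
independent set `E ∖ Z`, so `insert y X ⊆ cl Z` is independent and has `#X + 1 ≤ eRk (cl Z) = k` elements. -/
lemma ncard_excess_le {y : α} (hy : y ∈ M.E) {k : ℕ} {Z : Set α} (hZ : Z ∈ lowAbsorbAt M y k) :
    (M.closure Z \ insert y Z).ncard + 1 ≤ k := by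
  have hycl : y ∈ M.closure Z := mem_closure_of_mem_lowAbsorbAt M hy hZ
  obtain ⟨⟨hZE, hZk, hZind, hcind⟩, hyZ, -⟩ := hZ
  set X := M.closure Z \ insert y Z with hX
  have hXsub : insert y X ⊆ M.E \ Z := by
    intro x hx
    rcases Set.mem_insert_iff.mp hx with rfl | hx'
    · exact ⟨hy, hyZ⟩
    · exact ⟨M.closure_subset_ground Z hx'.1, fun h => hx'.2 (Set.mem_insert_of_mem _ h)⟩
  have hind : M.Indep (insert y X) := hcind.subset hXsub
  have hsubcl : insert y X ⊆ M.closure Z := Set.insert_subset hycl (fun x hx => hx.1)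
  have h1 := hind.encard_le_eRk_of_subset hsubcl
  have hyX : y ∉ X := fun h => h.2 (Set.mem_insert y Z)
  have hXfin : X.Finite := (M.ground_finite.subset (M.closure_subset_ground Z)).subset Set.sdiff_subset
  rw [M.eRk_closure_eq, hZind.eRk_eq_encard, ← Set.Finite.cast_ncard_eq (M.ground_finite.subset hZE), hZk,
    Set.encard_insert_of_notMem hyX, ← Set.Finite.cast_ncard_eq hXfin] at h1
  exact_mod_cast h1

open Classical in
/-- **The closure of a member, as a `Finset`**: the elements of `E` in `cl Z`. -/
noncomputable def clFinset (Z : Finset α) : Finset α := (absGround M).filter (fun e => e ∈ M.closure (↑Z : Set α))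

omit [DecidableEq α] in
/-- Membership in `clFinset`. -/
lemma mem_clFinset {Z : Finset α} {e : α} : e ∈ clFinset M Z ↔ e ∈ M.closure (↑Z : Set α) := by
  simp only [clFinset, Finset.mem_filter, mem_absGround, and_iff_right_iff_imp]
  exact fun h => M.closure_subset_ground _ h

/-- **`#clFinset Z ≤ #Z + 1 + (k − 1) = 2k`** for a member `Z` at level `k`: `cl Z = Z ∪ {y} ∪ excess`. -/
lemma card_clFinset_le {y : α} (hy : y ∈ M.E) {k : ℕ} {Z : Finset α} (hZ : Z ∈ absorbFinset M y k) :
    (clFinset M Z).card ≤ 2 * k := by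
  have hZ' := (mem_absorbFinset M).mp hZ
  have hex := ncard_excess_le M hy hZ'
  have hZE : (↑Z : Set α) ⊆ M.E := hZ'.1.1
  have hZk : Z.card = k := by have := hZ'.1.2.1; rwa [Set.ncard_coe_finset] at this
  have hyZ : y ∉ Z := by simpa using hZ'.2.1
  -- `clFinset Z ⊆ insert y Z ∪ (excess as a Finset)`
  have hXfin : (M.closure (↑Z : Set α) \ insert y ↑Z).Finite :=
    (M.ground_finite.subset (M.closure_subset_ground _)).subset Set.sdiff_subset
  have hsub : clFinset M Z ⊆ insert y Z ∪ hXfin.toFinset := by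
    intro e he
    rw [mem_clFinset] at he
    rw [Finset.mem_union, Finset.mem_insert, Set.Finite.mem_toFinset]
    by_cases h : e ∈ insert y (↑Z : Set α)
    · left; simpa using h
    · right; exact ⟨he, h⟩
  have h1 := Finset.card_le_card hsub
  have h2 : (insert y Z ∪ hXfin.toFinset).card ≤ (insert y Z).card + hXfin.toFinset.card := Finset.card_union_le _ _
  have h3 : hXfin.toFinset.card = (M.closure (↑Z : Set α) \ insert y ↑Z).ncard :=
    (Set.ncard_eq_toFinset_card _ hXfin).symm
  rw [Finset.card_insert_of_notMem hyZ, hZk] at h2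
  omega

/-- **The up-neighbours of `Z`**: the members `W` at level `k + 1` containing `Z`. -/
noncomputable def upNbrs (y : α) (k : ℕ) (Z : Finset α) : Finset (Finset α) :=
  (absorbFinset M y (k + 1)).filter (fun W => Z ⊆ W)

/-- **The down-neighbours of `W`**: the members `Z` at level `k` contained in `W`. -/
noncomputable def downNbrs (y : α) (k : ℕ) (W : Finset α) : Finset (Finset α) :=
  (absorbFinset M y k).filter (fun Z => Z ⊆ W)

/-- **The up-neighbours of a member `Z` are the sets `insert e Z`, `e ∈ E ∖ cl Z`**: `#upNbrs Z = #E − #clFinset Z`. -/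
lemma card_upNbrs {y : α} (hy : y ∈ M.E) {k : ℕ} {Z : Finset α} (hZ : Z ∈ absorbFinset M y k) :
    (upNbrs M y k Z).card = (absGround M \ clFinset M Z).card := by
  have hZ' := (mem_absorbFinset M).mp hZ
  have hZk : Z.card = k := by have := hZ'.1.2.1; rwa [Set.ncard_coe_finset] at this
  symm
  refine Finset.card_bij (fun e _ => insert e Z) ?_ ?_ ?_
  · intro e he
    rw [Finset.mem_sdiff, mem_absGround, mem_clFinset] at he
    rw [upNbrs, Finset.mem_filter]
    exact ⟨insert_mem_absorbFinset M hy hZ he.1 he.2, Finset.subset_insert _ _⟩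
  · intro e he e' he' h
    rw [Finset.mem_sdiff, mem_clFinset] at he he'
    have heZ : e ∉ Z := fun hz => he.2 (M.subset_closure _ hZ'.1.1 (by simpa using hz))
    exact (Finset.insert_inj heZ).mp h
  · intro W hW
    rw [upNbrs, Finset.mem_filter] at hW
    obtain ⟨hWA, hZW⟩ := hW
    have hW' := (mem_absorbFinset M).mp hWA
    have hWk : W.card = k + 1 := by have := hW'.1.2.1; rwa [Set.ncard_coe_finset] at this
    have hcard : (W \ Z).card = 1 := by rw [Finset.card_sdiff_of_subset hZW, hWk, hZk]; omega
    obtain ⟨e, he⟩ := Finset.card_eq_one.mp hcard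
    have heW : e ∈ W := (Finset.mem_sdiff.mp (he ▸ Finset.mem_singleton_self e)).1
    have heZ : e ∉ Z := (Finset.mem_sdiff.mp (he ▸ Finset.mem_singleton_self e)).2
    have hWeq : W = insert e Z := by
      ext x
      constructor
      · intro hx
        by_cases hxZ : x ∈ Z
        · exact Finset.mem_insert_of_mem hxZ
        · have : x ∈ W \ Z := Finset.mem_sdiff.mpr ⟨hx, hxZ⟩
          rw [he, Finset.mem_singleton] at this
          rw [this]; exact Finset.mem_insert_self _ _
      · intro hx
        rcases Finset.mem_insert.mp hx with rfl | hx'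
        · exact heW
        · exact hZW hx'
    refine ⟨e, ?_, hWeq.symm⟩
    rw [Finset.mem_sdiff, mem_absGround, mem_clFinset]
    refine ⟨hW'.1.1 (by simpa using heW), fun hecl => ?_⟩
    have hind := hW'.1.2.2.1
    rw [hWeq, Finset.coe_insert, (hZ'.1.2.2.1).insert_indep_iff_of_notMem (by simpa using heZ)] at hind
    exact hind.2 hecl

/-- **A member at level `k` has at least `#E − 2k` up-neighbours.** -/
lemma card_upNbrs_ge {y : α} (hy : y ∈ M.E) {k : ℕ} {Z : Finset α} (hZ : Z ∈ absorbFinset M y k) :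
    M.E.ncard ≤ (upNbrs M y k Z).card + 2 * k := by
  have hsub : clFinset M Z ⊆ absGround M := fun e he =>
    (mem_absGround M).mpr (M.closure_subset_ground _ ((mem_clFinset M).mp he))
  rw [card_upNbrs M hy hZ, Finset.card_sdiff_of_subset hsub, card_absGround]
  have := card_clFinset_le M hy hZ
  omega

/-! ## The excess `Finset` and the exact up-neighbour count -/

/-- **The excess of a member, as a `Finset`**: `clFinset Z ∖ insert y Z`. -/
noncomputable def exFinset (y : α) (Z : Finset α) : Finset α := clFinset M Z \ insert y Z

/-- Membership in `exFinset`. -/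
lemma mem_exFinset {y : α} {Z : Finset α} {e : α} :
    e ∈ exFinset M y Z ↔ e ∈ M.closure (↑Z : Set α) ∧ e ≠ y ∧ e ∉ Z := by
  simp only [exFinset, Finset.mem_sdiff, mem_clFinset, Finset.mem_insert, not_or]

/-- **`#clFinset Z = #Z + 1 + #exFinset Z`** for a member `Z` at level `k` (`y ∈ E`). -/
lemma card_clFinset_eq {y : α} (hy : y ∈ M.E) {k : ℕ} {Z : Finset α} (hZ : Z ∈ absorbFinset M y k) :
    (clFinset M Z).card = Z.card + 1 + (exFinset M y Z).card := by
  have hZ' := (mem_absorbFinset M).mp hZ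
  have hyZ : y ∉ Z := by simpa using hZ'.2.1
  have hsub : insert y Z ⊆ clFinset M Z := by
    intro e he
    rw [mem_clFinset]
    rcases Finset.mem_insert.mp he with rfl | he'
    · exact mem_closure_of_mem_lowAbsorbAt M hy hZ'
    · exact M.subset_closure _ hZ'.1.1 (by simpa using he')
  rw [exFinset, Finset.card_sdiff_of_subset hsub, Finset.card_insert_of_notMem hyZ]
  have := Finset.card_le_card hsub
  rw [Finset.card_insert_of_notMem hyZ] at this
  omega

/-- **The excess of a member at level `k` has at most `k − 1` elements** (`Finset` form of `ncard_excess_le`). -/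
lemma card_exFinset_le {y : α} (hy : y ∈ M.E) {k : ℕ} {Z : Finset α} (hZ : Z ∈ absorbFinset M y k) :
    (exFinset M y Z).card + 1 ≤ k := by
  have hZ' := (mem_absorbFinset M).mp hZ
  have h := ncard_excess_le M hy hZ'
  have hXfin : (M.closure (↑Z : Set α) \ insert y ↑Z).Finite :=
    (M.ground_finite.subset (M.closure_subset_ground _)).subset Set.sdiff_subset
  have heq : exFinset M y Z = hXfin.toFinset := by
    ext e
    rw [mem_exFinset, Set.Finite.mem_toFinset, Set.mem_sdiff, Set.mem_insert_iff, Finset.mem_coe]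
    tauto
  rw [heq, ← Set.ncard_eq_toFinset_card _ hXfin]
  exact h

/-- **The number of up-neighbours of a member at level `k`**: `#E − (#Z + 1 + #exFinset Z)`. -/
lemma card_upNbrs_eq {y : α} (hy : y ∈ M.E) {k : ℕ} {Z : Finset α} (hZ : Z ∈ absorbFinset M y k) :
    (upNbrs M y k Z).card + (k + 1 + (exFinset M y Z).card) = M.E.ncard := by
  have hZ' := (mem_absorbFinset M).mp hZ
  have hZk : Z.card = k := by have := hZ'.1.2.1; rwa [Set.ncard_coe_finset] at this
  have hsub : clFinset M Z ⊆ absGround M := fun e he =>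
    (mem_absGround M).mpr (M.closure_subset_ground _ ((mem_clFinset M).mp he))
  have h1 := card_clFinset_eq M hy hZ
  have h2 := Finset.card_le_card hsub
  rw [card_upNbrs M hy hZ, Finset.card_sdiff_of_subset hsub, card_absGround]
  rw [card_absGround] at h2
  rw [hZk] at h1
  omega

/-- A down-neighbour of `W` at level `k` is `W.erase e` for some `e ∈ W` (`#W = k + 1`). -/
lemma exists_erase_of_mem_downNbrs {y : α} {k : ℕ} {W : Finset α} (hW : W ∈ absorbFinset M y (k + 1))
    {Z : Finset α} (hZ : Z ∈ downNbrs M y k W) : ∃ e ∈ W, Z = W.erase e ∧ e ∉ Z := by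
  rw [downNbrs, Finset.mem_filter] at hZ
  obtain ⟨hZA, hZW⟩ := hZ
  have hW' := (mem_absorbFinset M).mp hW
  have hZ' := (mem_absorbFinset M).mp hZA
  have hWk : W.card = k + 1 := by have := hW'.1.2.1; rwa [Set.ncard_coe_finset] at this
  have hZk : Z.card = k := by have := hZ'.1.2.1; rwa [Set.ncard_coe_finset] at this
  have hcard : (W \ Z).card = 1 := by rw [Finset.card_sdiff_of_subset hZW, hWk, hZk]; omega
  obtain ⟨e, he⟩ := Finset.card_eq_one.mp hcard
  have heW : e ∈ W := (Finset.mem_sdiff.mp (he ▸ Finset.mem_singleton_self e)).1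
  have heZ : e ∉ Z := (Finset.mem_sdiff.mp (he ▸ Finset.mem_singleton_self e)).2
  refine ⟨e, heW, ?_, heZ⟩
  ext x
  rw [Finset.mem_erase]
  constructor
  · intro hx
    exact ⟨fun h => heZ (h ▸ hx), hZW hx⟩
  · rintro ⟨hxe, hxW⟩
    by_contra hxZ
    have : x ∈ W \ Z := Finset.mem_sdiff.mpr ⟨hxW, hxZ⟩
    rw [he, Finset.mem_singleton] at this
    exact hxe this


/-! ## Full excess forces a unique down-neighbour -/

/-- **Full excess forces a unique down-neighbour**: if `Z ∈ downNbrs W` at level `3` has two distinct excess elements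
`f, g`, then `{f, g, y}` spans `cl Z ⊇ Z`, so every `e' ∈ Z` lies in `cl (E ∖ W)` and `W.erase e' ∉ A_3`; hence
`downNbrs W = {Z}`. -/
lemma downNbrs_eq_singleton_of_excess {y : α} (hy : y ∈ M.E) {W : Finset α} (hW : W ∈ absorbFinset M y 4)
    {Z : Finset α} (hZ : Z ∈ downNbrs M y 3 W) {f g : α} (hf : f ∈ exFinset M y Z) (hg : g ∈ exFinset M y Z)
    (hfg : f ≠ g) : downNbrs M y 3 W = {Z} := by
  obtain ⟨e, heW, rfl, heZ⟩ := exists_erase_of_mem_downNbrs M hW hZ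
  have hW' := (mem_absorbFinset M).mp hW
  have hZA : W.erase e ∈ absorbFinset M y 3 := (Finset.mem_filter.mp hZ).1
  have hZ' := (mem_absorbFinset M).mp hZA
  rw [mem_exFinset] at hf hg
  have hycl : y ∈ M.closure (↑(W.erase e) : Set α) := mem_closure_of_mem_lowAbsorbAt M hy hZ'
  have hyW : y ∉ W := by simpa using hW'.2.1
  have hfE : f ∈ M.E := M.closure_subset_ground _ hf.1
  have hgE : g ∈ M.E := M.closure_subset_ground _ hg.1
  -- `e ∉ cl (W.erase e)` since `W` is independent
  have hecl : e ∉ M.closure (↑(W.erase e) : Set α) := by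
    intro h
    have hind := hW'.1.2.2.1
    rw [← Finset.insert_erase heW, Finset.coe_insert,
      (hZ'.1.2.2.1).insert_indep_iff_of_notMem (fun h => heZ (Finset.mem_coe.mp h))] at hind
    exact hind.2 h
  have hfW : f ∉ W := by
    intro h
    rcases Finset.mem_insert.mp ((Finset.insert_erase heW).symm ▸ h) with rfl | h'
    · exact hecl hf.1
    · exact hf.2.2 h'
  have hgW : g ∉ W := by
    intro h
    rcases Finset.mem_insert.mp ((Finset.insert_erase heW).symm ▸ h) with rfl | h'
    · exact hecl hg.1
    · exact hg.2.2 h'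
  -- `{f, g, y} ⊆ E ∖ W` is independent and lies in `cl (W.erase e)` (rank `3`)
  have hsubc : ({f, g, y} : Set α) ⊆ M.E \ ↑W := by
    intro x hx
    simp only [Set.mem_insert_iff, Set.mem_singleton_iff] at hx
    rcases hx with rfl | rfl | rfl
    · exact ⟨hfE, by simpa using hfW⟩
    · exact ⟨hgE, by simpa using hgW⟩
    · exact ⟨hy, by simp [hyW]⟩
  have hind3 : M.Indep {f, g, y} := hW'.1.2.2.2.subset hsubc
  have hsubcl : ({f, g, y} : Set α) ⊆ M.closure (↑(W.erase e) : Set α) := by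
    intro x hx
    simp only [Set.mem_insert_iff, Set.mem_singleton_iff] at hx
    rcases hx with rfl | rfl | rfl
    · exact hf.1
    · exact hg.1
    · exact hycl
  -- every `e' ∈ W.erase e` lies in `cl {f, g, y} ⊆ cl (E ∖ W)`
  have hZcl : ∀ e' ∈ W.erase e, e' ∈ M.closure (M.E \ ↑W) := by
    intro e' he'
    have he'cl : e' ∈ M.closure (↑(W.erase e) : Set α) := M.subset_closure _ hZ'.1.1 (Finset.mem_coe.mpr he')
    have he'E : e' ∈ M.E := hZ'.1.1 (Finset.mem_coe.mpr he')
    by_contra hno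
    have hno' : e' ∉ M.closure ({f, g, y} : Set α) := fun h => hno (M.closure_subset_closure hsubc h)
    have he'nm : e' ∉ ({f, g, y} : Set α) := fun h => hno' (M.subset_closure _ (hsubc.trans Set.sdiff_subset) h)
    have hind4 : M.Indep (insert e' {f, g, y}) := (hind3.insert_indep_iff_of_notMem he'nm).mpr ⟨he'E, hno'⟩
    have h1 := hind4.encard_le_eRk_of_subset (Set.insert_subset he'cl hsubcl)
    have hZk : (W.erase e).card = 3 := by have := hZ'.1.2.1; rwa [Set.ncard_coe_finset] at this
    have hfgy : f ∉ ({g, y} : Set α) := by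
      simp only [Set.mem_insert_iff, Set.mem_singleton_iff, not_or]; exact ⟨hfg, hf.2.1⟩
    rw [M.eRk_closure_eq, (hZ'.1.2.2.1).eRk_eq_encard, Set.encard_coe_eq_coe_finsetCard, hZk,
      Set.encard_insert_of_notMem he'nm, Set.encard_insert_of_notMem hfgy, Set.encard_pair hg.2.1] at h1
    norm_num at h1
  -- hence no other down-neighbour
  ext Z'
  rw [Finset.mem_singleton]
  constructor
  · intro hZ'mem
    obtain ⟨e', he'W, rfl, he'Z'⟩ := exists_erase_of_mem_downNbrs M hW hZ'mem
    by_contra hne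
    have he'ne : e' ≠ e := fun h => hne (by rw [h])
    have he'Z : e' ∈ W.erase e := Finset.mem_erase.mpr ⟨he'ne, he'W⟩
    have hmem := (Finset.mem_filter.mp hZ'mem).1
    have hZ'' := (mem_absorbFinset M).mp hmem
    have hcind := hZ''.1.2.2.2
    -- `E ∖ (W.erase e') = insert e' (E ∖ W)` is dependent
    have hcompl : M.E \ (↑(W.erase e') : Set α) = insert e' (M.E \ ↑W) := by
      rw [Finset.coe_erase]
      ext x
      simp only [Set.mem_sdiff, Set.mem_insert_iff, Set.mem_singleton_iff, Finset.mem_coe]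
      constructor
      · rintro ⟨hxE, hx⟩
        by_cases hxe : x = e'
        · exact Or.inl hxe
        · exact Or.inr ⟨hxE, fun hxW => hx ⟨hxW, hxe⟩⟩
      · rintro (rfl | ⟨hxE, hxW⟩)
        · exact ⟨hZ'.1.1 (Finset.mem_coe.mpr he'Z), fun h => h.2 rfl⟩
        · exact ⟨hxE, fun h => hxW h.1⟩
    rw [hcompl, (hW'.1.2.2.2).insert_indep_iff_of_notMem (fun h => h.2 (Finset.mem_coe.mpr he'W))] at hcind
    exact hcind.2 (hZcl e' he'Z)
  · rintro rfl
    exact hZ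


end PercRepro
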